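import Mathlib
import Summits.CriticalPhenomena.CardyFormulaZ2.Theorems.CardyFlipRussoSquareFromVoronoiHubFaithfulDefs
import Summits.CriticalPhenomena.CardyFormulaZ2.Theorems.CardyFlipRussoSquareFromVoronoiHubPerturbedRectanglesPart1
import Summits.CriticalPhenomena.CardyFormulaZ2.Theorems.CardyIKTransportIKLinearTransportStubCouplingToLimitsGeometry
import Summits.CriticalPhenomena.CardyFormulaZ2.Theorems.CardyMagicRigidityLoopsToCrossingsStubCyclicFlip
import Literature.Probability.Percolation.QuadCrossingSquareModel
import Literature.Probability.Percolation.CardyCarleson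
import Literature.Probability.RandomPlanarGeometry.CrossRatioContinuity
import Literature.Probability.RandomPlanarGeometry.CardyFunctionIncBeta
import Literature.Probability.RandomPlanarGeometry.ConformalRectangleShift

/-!
# S1 `stub_perturbedRectangles`: perturbed conformal rectangles (line `Sketch`, crux `SquareFromVoronoiHub`)

Crux `Summit.CriticalPhenomena.CardyFormulaZ2.Theses.CardyFlipRusso.SquareFromVoronoiHub`
(stmt-CriticalPhenomena-6434), line `Sketch`, K1 ("faithful discretisation"), registered stub
`stub_perturbedRectangles` (S1 — pure conformal / plane geometry, no probability), proved here under
its registered name, over the specifications `lowerMargins` / `upperMargins` of the module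
`…FaithfulDefs`.

Construction (Bollobás–Riordan, *Percolation* (2006), Ch. 7 p. 186, comparison rectangles; realised
with Schramm–Smirnov's perturbed quads, Ann. Probab. 39 (2011), proof of Lemma 5.1).  Let `Φ` be a
square model of `R = (Ω; a, b, c, d)` (`exists_isSquareModel`: a homeomorphism of the plane mapping the
model square `(-1,1)²` onto `Ω` and side `k` onto `R.arc k`, from the Schoenflies theorem), and `Φ₂` a
square model of the cyclically re-marked rectangle `(Ω; b, c, d, a)` (`MarkedDomain.exists_shiftMarks`).
For `κ > 0`:
* `R₁ = Φ([-1+κ, 1-κ] × [-1-κ, 1+κ])` — the LOWER rectangle (caps beyond `(ab)`, `(cd)`, collars off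
  `(bc)`, `(da)`), cap sets `F₀ = Φ([-1+κ/2, 1-κ/2] × [-1-2κ, -1])`, `F₂ = Φ([-1+κ/2, 1-κ/2] × [1, 1+2κ])`;
* `R₂ = Φ₂([-1+κ, 1-κ] × [-1-κ, 1+κ])` — the UPPER (conjugate) rectangle: caps beyond `(bc)`, `(da)`,
  collars off `(ab)`, `(cd)`, its arc `0` being the cap edge behind `(bc)`.

* `Perturbed.exists_cardy_close` — **the Cardy clause**: for `κ` small the two perturbed quads have
  uniformizing data whose Cardy values are within `θ` of `F(η_R)` and `1 - F(η_R)`: the boundary loops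
  of the perturbed quads converge uniformly to those of the unperturbed ones
  (`tendstoUniformly_boundary_perturbQuad`), so Radó's theorem in the tree's form
  `ConformalRectangle.tendsto_crossRatio_of_tendsto_mark` gives convergence of the moduli; the
  unperturbed quads have the carrier and marked points of `R`, resp. of the re-marked rectangle, whose
  modulus is `1 - η_R` (`crossRatio_eq_one_sub_of_cyclic_boundaryValues`, Möbius bookkeeping), and
  `F(1 - η) = 1 - F(η)` (`cardyFunction_one_sub_holds`), `F` continuous on `(0,1)`.
* `stub_perturbedRectangles` — assembly: part 1 gives the metric clauses of `lowerMargins` and the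
  crossing clause of `upperMargins` for all small `r > 0` (`Perturbed.eventually_lower`,
  `Perturbed.eventually_crossing`); a common small `r` is extracted from the filter `𝓝[>] 0`.

References: Ch. Pommerenke, *Boundary Behaviour of Conformal Maps* (1992), Thm. 2.11 (Radó), Cor. 2.9
(Schoenflies); O. Schramm, S. Smirnov, Ann. Probab. 39 (2011), proof of Lemma 5.1; B. Bollobás,
O. Riordan, *Percolation* (2006), Ch. 7 p. 186.
-/

noncomputable section

namespace Summit.CriticalPhenomena.CardyFormulaZ2.Cruxes.SquareFromVoronoiHub.VoronoiBlocks.Faithful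

open scoped Topology
open Set Filter Metric
open UpperHalfPlane (upperHalfPlaneSet)
open Literature.Probability.Percolation (perturbQuad unitSquareQuad IsSquareModel exists_isSquareModel)
open Literature.Probability.RandomPlanarGeometry (ConformalRectangle ConformalEquiv MarkedDomain
  cardyFunction crossRatio cardyFunction_one_sub_holds continuousOn_cardyFunction_Ioo)
open Summit.CriticalPhenomena.CardyFormulaZ2.Theorems.IKLinearTransport.PinnedDiagramExchange.CouplingToLimits
  (tendstoUniformly_boundary_perturbQuad isSquareModel_perturbQuad_carrier isSquareModel_perturbQuad_pt)
open Summit.CriticalPhenomena.CardyFormulaZ2.Cruxes.LoopsToCrossings.OracleSandwich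
  (crossRatio_eq_one_sub_of_cyclic_boundaryValues)

namespace Perturbed

/-! ### The Cardy clause: moduli of the perturbed quads (Radó) -/

/-- Continuity of Cardy's function at a point of `(0, 1)`, `ε`–`δ` form. [folklore] -/
theorem exists_cardyFunction_near {η θ : ℝ} (hη : η ∈ Ioo (0 : ℝ) 1) (hθ : 0 < θ) :
    ∃ τ : ℝ, 0 < τ ∧ ∀ η' : ℝ, |η' - η| < τ → |cardyFunction η' - cardyFunction η| < θ := by
  have hc : ContinuousAt cardyFunction η :=
    continuousOn_cardyFunction_Ioo.continuousAt (Ioo_mem_nhds hη.1 hη.2)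
  obtain ⟨τ, hτ, h⟩ := Metric.continuousAt_iff.1 hc θ hθ
  refine ⟨τ, hτ, fun η' hη' => ?_⟩
  have := h (by rwa [Real.dist_eq])
  rwa [Real.dist_eq] at this

/-- **The Cardy clause of `stub_perturbedRectangles`.**  Let `Φ` be a square model of `R` and `Φ₂` a
square model of a rectangle `R'` with the same carrier and the marked points of `R` shifted by one
(`R'.pt i = R.pt (i + 1)`).  For every `θ > 0` there is `κ ∈ (0, 1/4]` such that the perturbed quads
`Φ([-1+κ, 1-κ] × [-1-κ, 1+κ])` and `Φ₂([-1+κ, 1-κ] × [-1-κ, 1+κ])` have uniformizing data `(φ₁, x₁)`,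
`(φ₂, x₂)` with `|F(η(x₁)) - F(η(x))| ≤ θ` and `|(1 - F(η(x₂))) - F(η(x))| ≤ θ` for EVERY uniformizing
datum `(φ, x)` of `R` (Radó continuity of the modulus along the uniformly convergent boundary loops,
`tendsto_crossRatio_of_tendsto_mark`; the modulus of the re-marked rectangle is `1 - η_R`,
`crossRatio_eq_one_sub_of_cyclic_boundaryValues`; `F(1 - η) = 1 - F(η)`). [folklore] -/
theorem exists_cardy_close {R R' : ConformalRectangle} {Φ Φ₂ : ℂ ≃ₜ ℂ} (hΦ : IsSquareModel R Φ)
    (hc' : R'.carrier = R.carrier) (hpt' : ∀ i, R'.pt i = R.pt (i + 1)) (hΦ₂ : IsSquareModel R' Φ₂)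
    {θ : ℝ} (hθ : 0 < θ) :
    ∃ κ : ℝ, 0 < κ ∧ κ ≤ 1 / 4 ∧ ∃ (hx : -1 + κ < 1 - κ) (hy : -1 - κ < 1 + κ)
      (φ₁ : ConformalEquiv upperHalfPlaneSet (perturbQuad Φ (-1 + κ) (1 - κ) (-1 - κ) (1 + κ) hx hy).carrier)
      (x₁ : Fin 4 → ℝ)
      (φ₂ : ConformalEquiv upperHalfPlaneSet (perturbQuad Φ₂ (-1 + κ) (1 - κ) (-1 - κ) (1 + κ) hx hy).carrier)
      (x₂ : Fin 4 → ℝ),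
      (perturbQuad Φ (-1 + κ) (1 - κ) (-1 - κ) (1 + κ) hx hy).IsUniformizing φ₁ x₁ ∧
      (perturbQuad Φ₂ (-1 + κ) (1 - κ) (-1 - κ) (1 + κ) hx hy).IsUniformizing φ₂ x₂ ∧
      ∀ (φ : ConformalEquiv upperHalfPlaneSet R.carrier) (x : Fin 4 → ℝ), R.IsUniformizing φ x →
        |cardyFunction (crossRatio x₁) - cardyFunction (crossRatio x)| ≤ θ ∧
        |(1 - cardyFunction (crossRatio x₂)) - cardyFunction (crossRatio x)| ≤ θ := by
  have hn1 : (-1 : ℝ) < 1 := by norm_num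
  -- reference data on the unperturbed quads
  obtain ⟨φ₀, x₀, hφ₀⟩ := MarkedDomain.exists_isUniformizing_holds (perturbQuad Φ (-1) 1 (-1) 1 hn1 hn1)
  obtain ⟨ψ₀, z₀, hψ₀⟩ := MarkedDomain.exists_isUniformizing_holds (perturbQuad Φ₂ (-1) 1 (-1) 1 hn1 hn1)
  -- every datum of `R` has the modulus of the unperturbed quad of `Φ`
  have hη : ∀ (φ : ConformalEquiv upperHalfPlaneSet R.carrier) (x : Fin 4 → ℝ), R.IsUniformizing φ x →
      crossRatio x = crossRatio x₀ := fun φ x hφx =>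
    ConformalRectangle.crossRatio_eq_of_image_data (R := R) (S := perturbQuad Φ (-1) 1 (-1) 1 hn1 hn1)
      (h := id) differentiableOn_id (injOn_id _) continuousOn_id
      (by rw [Set.image_id, isSquareModel_perturbQuad_carrier hΦ])
      (fun i => by rw [id, isSquareModel_perturbQuad_pt hΦ]) hφx hφ₀
  -- and `1 -` the modulus of the unperturbed quad of `Φ₂` (cyclic re-marking)
  have hcS : (perturbQuad Φ₂ (-1) 1 (-1) 1 hn1 hn1).carrier = R.carrier :=
    (isSquareModel_perturbQuad_carrier hΦ₂ hn1 hn1).trans hc'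
  have hbv : ∀ i, (ψ₀.trans (ConformalEquiv.ofEq hcS)).HasBoundaryValue (z₀ i)
      ((perturbQuad Φ₂ (-1) 1 (-1) 1 hn1 hn1).pt i) := fun i =>
    ConformalEquiv.hasBoundaryValue_trans _ _ (hψ₀.2 i) (ConformalEquiv.hasBoundaryValue_ofEq hcS _)
  have hp : ∀ i, (perturbQuad Φ₂ (-1) 1 (-1) 1 hn1 hn1).pt i = R.pt (i + 1) := fun i => by
    rw [isSquareModel_perturbQuad_pt hΦ₂, hpt']
  have hη' : ∀ (φ : ConformalEquiv upperHalfPlaneSet R.carrier) (x : Fin 4 → ℝ), R.IsUniformizing φ x →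
      crossRatio z₀ = 1 - crossRatio x := fun φ x hφx =>
    crossRatio_eq_one_sub_of_cyclic_boundaryValues R hφx _ hψ₀.1 hbv (hp 0) (hp 1) (hp 2) (hp 3)
  have hη₁ := ConformalRectangle.crossRatio_mem_Ioo_of_isUniformizing hφ₀
  have hη₂ := ConformalRectangle.crossRatio_mem_Ioo_of_isUniformizing hψ₀
  obtain ⟨τ₁, hτ₁, hF₁⟩ := exists_cardyFunction_near hη₁ hθ
  obtain ⟨τ₂, hτ₂, hF₂⟩ := exists_cardyFunction_near hη₂ hθ
  -- the family of model rectangles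
  set s : ℕ → ℝ := fun n => 1 / ((n : ℝ) + 1) / 4 with hsdef
  have hs0 : ∀ n, 0 < s n := fun n => by positivity
  have hs4 : ∀ n, s n ≤ 1 / 4 := fun n => by
    have h1 : 1 / ((n : ℝ) + 1) ≤ 1 := by
      rw [div_le_one (by positivity)]; linarith [n.cast_nonneg (α := ℝ)]
    show 1 / ((n : ℝ) + 1) / 4 ≤ 1 / 4
    linarith
  have hs : Tendsto s atTop (𝓝 0) := by
    have := (tendsto_one_div_add_atTop_nhds_zero_nat (𝕜 := ℝ)).div_const (4 : ℝ)
    rw [hsdef]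
    simpa using this
  have hTx : ∀ n, -1 + s n < 1 - s n := fun n => by linarith [hs4 n]
  have hTy : ∀ n, -1 - s n < 1 + s n := fun n => by linarith [hs0 n]
  have hex₁ := fun n => MarkedDomain.exists_isUniformizing_holds
    (perturbQuad Φ (-1 + s n) (1 - s n) (-1 - s n) (1 + s n) (hTx n) (hTy n))
  have hex₂ := fun n => MarkedDomain.exists_isUniformizing_holds
    (perturbQuad Φ₂ (-1 + s n) (1 - s n) (-1 - s n) (1 + s n) (hTx n) (hTy n))
  choose ψ₁ y₁ hψ₁ using hex₁
  choose ψ₂ y₂ hψ₂ using hex₂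
  have hl1 : Tendsto (fun n => -1 + s n) atTop (𝓝 (-1)) := by
    simpa using (tendsto_const_nhds (x := (-1 : ℝ))).add hs
  have hl2 : Tendsto (fun n => 1 - s n) atTop (𝓝 1) := by
    simpa using (tendsto_const_nhds (x := (1 : ℝ))).sub hs
  have hl3 : Tendsto (fun n => -1 - s n) atTop (𝓝 (-1)) := by
    simpa using (tendsto_const_nhds (x := (-1 : ℝ))).sub hs
  have hl4 : Tendsto (fun n => 1 + s n) atTop (𝓝 1) := by
    simpa using (tendsto_const_nhds (x := (1 : ℝ))).add hs
  -- Radó: the moduli converge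
  have hc₁ : Tendsto (fun n => crossRatio (y₁ n)) atTop (𝓝 (crossRatio x₀)) :=
    ConformalRectangle.tendsto_crossRatio_of_tendsto_mark
      (tendstoUniformly_boundary_perturbQuad Φ hTx hTy hn1 hn1 hl1 hl2 hl3 hl4)
      (fun i => tendsto_const_nhds) ψ₁ y₁ hψ₁ φ₀ x₀ hφ₀
  have hc₂ : Tendsto (fun n => crossRatio (y₂ n)) atTop (𝓝 (crossRatio z₀)) :=
    ConformalRectangle.tendsto_crossRatio_of_tendsto_mark
      (tendstoUniformly_boundary_perturbQuad Φ₂ hTx hTy hn1 hn1 hl1 hl2 hl3 hl4)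
      (fun i => tendsto_const_nhds) ψ₂ y₂ hψ₂ ψ₀ z₀ hψ₀
  obtain ⟨n, hn₁, hn₂⟩ : ∃ n, |crossRatio (y₁ n) - crossRatio x₀| < τ₁ ∧
      |crossRatio (y₂ n) - crossRatio z₀| < τ₂ := by
    obtain ⟨n, hn⟩ := (((Metric.tendsto_nhds.1 hc₁) τ₁ hτ₁).and ((Metric.tendsto_nhds.1 hc₂) τ₂ hτ₂)).exists
    exact ⟨n, by simpa only [Real.dist_eq] using hn.1, by simpa only [Real.dist_eq] using hn.2⟩
  refine ⟨s n, hs0 n, hs4 n, hTx n, hTy n, ψ₁ n, y₁ n, ψ₂ n, y₂ n, hψ₁ n, hψ₂ n, fun φ x hφx => ⟨?_, ?_⟩⟩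
  · rw [hη φ x hφx]
    exact (hF₁ _ hn₁).le
  · have e : crossRatio x = 1 - crossRatio z₀ := by linarith [hη' φ x hφx]
    rw [e, cardyFunction_one_sub_holds ⟨hη₂.1.le, hη₂.2.le⟩]
    have h := hF₂ _ hn₂
    rw [abs_sub_comm] at h
    have e2 : (1 - cardyFunction (crossRatio (y₂ n))) - (1 - cardyFunction (crossRatio z₀)) =
        cardyFunction (crossRatio z₀) - cardyFunction (crossRatio (y₂ n)) := by ring
    rw [e2]
    exact h.le

end Perturbed

/-! ### Assembly -/

/-- The marked points of the cyclically re-marked rectangle of `MarkedDomain.exists_shiftMarks` are those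
of `R` shifted by one: `R'.pt i = R.pt (i + 1)`. [folklore] -/
theorem Perturbed.pt_of_shiftMarks {R R' : ConformalRectangle}
    (hb : ∀ u, R'.boundary u = R.boundary (u + R.mark 1))
    (hm : ∀ i, R'.mark i = ![0, R.mark 2 - R.mark 1, R.mark 3 - R.mark 1, R.mark 0 + 1 - R.mark 1] i)
    (i : Fin 4) : R'.pt i = R.pt (i + 1) := by
  show R'.boundary (R'.mark i) = R.boundary (R.mark (i + 1))
  rw [hb, hm]
  fin_cases i
  · simp
  · simp
  · simp
  · simp only [Fin.reduceFinMk, Matrix.cons_val, sub_add_cancel, Fin.isValue]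
    rw [R.periodic_boundary]
    rfl

/-- **S1 — perturbed conformal rectangles** (registered stub `stub_perturbedRectangles` of line
`Sketch`, crux `SquareFromVoronoiHub`, stmt-CriticalPhenomena-6434).  For every conformal rectangle `R`
and `θ > 0` there are conformal rectangles `R₁` (caps beyond `(ab)`, `(cd)`, collars off `(bc)`, `(da)`)
and `R₂` (caps beyond `(bc)`, `(da)`, collars off `(ab)`, `(cd)`, marked from the cap behind `(bc)`), with
uniformizing data, Cardy values within `θ` of `F(η_R)` resp. `1 - F(η_R)` against every uniformizing
datum of `R`, cap sets `F₀, F₂` and a margin `r > 0` in `lowerMargins R R₁ F₀ F₂ ∩ upperMargins R R₂`.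
Square models (Schoenflies) of `R` and of its cyclic re-marking, Schramm–Smirnov perturbed quads, Radó
continuity of the modulus, rectangle crossing lemma in the model. [folklore] -/
theorem stub_perturbedRectangles : ∀ (R : ConformalRectangle) (θ : ℝ), 0 < θ →
    ∃ (R₁ R₂ : ConformalRectangle) (φ₁ : ConformalEquiv upperHalfPlaneSet R₁.carrier)
      (x₁ : Fin 4 → ℝ) (φ₂ : ConformalEquiv upperHalfPlaneSet R₂.carrier) (x₂ : Fin 4 → ℝ)
      (F₀ F₂ : Set ℂ) (r : ℝ), R₁.IsUniformizing φ₁ x₁ ∧ R₂.IsUniformizing φ₂ x₂ ∧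
      (∀ (φ : ConformalEquiv upperHalfPlaneSet R.carrier) (x : Fin 4 → ℝ), R.IsUniformizing φ x →
          |cardyFunction (crossRatio x₁) - cardyFunction (crossRatio x)| ≤ θ ∧
          |(1 - cardyFunction (crossRatio x₂)) - cardyFunction (crossRatio x)| ≤ θ) ∧
        r ∈ lowerMargins R R₁ F₀ F₂ ∧ r ∈ upperMargins R R₂ := by
  intro R θ hθ
  -- square models of `R` and of its cyclic re-marking `(Ω; b, c, d, a)`
  obtain ⟨Φ, hΦ⟩ := exists_isSquareModel R
  obtain ⟨R', hc', hb', hm', -, ha1, -, ha3⟩ := MarkedDomain.exists_shiftMarks R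
  have hpt' : ∀ i, R'.pt i = R.pt (i + 1) := Perturbed.pt_of_shiftMarks hb' hm'
  obtain ⟨Φ₂, hΦ₂⟩ := exists_isSquareModel R'
  -- the Cardy clause fixes `κ`
  obtain ⟨κ, hκ, hκ4, hx, hy, φ₁, x₁, φ₂, x₂, h₁, h₂, hcardy⟩ :=
    Perturbed.exists_cardy_close hΦ hc' hpt' hΦ₂ hθ
  -- the margin clauses hold for all small `r > 0`
  have hlow := Perturbed.eventually_lower hΦ hκ (by linarith) hx hy
  have hA₀ : R.arc 0 = Φ₂ '' unitSquareQuad.arc 3 := by rw [← ha3, hΦ₂.image_arc]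
  have hA₂ : R.arc 2 = Φ₂ '' unitSquareQuad.arc 1 := by rw [← ha1, hΦ₂.image_arc]
  have hC : closure R.carrier = Φ₂ '' (Icc (-1) 1 ×ℂ Icc (-1) 1) := by rw [← hc', hΦ₂.image_Icc]
  have hup := Perturbed.eventually_crossing Φ₂ hκ (by linarith) hx hy hA₀ hA₂ hC
  obtain ⟨r, hr, ⟨hl1, hl2, hl3, hl4, hl5, hl6⟩, hu⟩ := (eventually_mem_nhdsWithin.and (hlow.and hup)).exists
  refine ⟨perturbQuad Φ (-1 + κ) (1 - κ) (-1 - κ) (1 + κ) hx hy,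
    perturbQuad Φ₂ (-1 + κ) (1 - κ) (-1 - κ) (1 + κ) hx hy, φ₁, x₁, φ₂, x₂,
    Φ.symm ⁻¹' (Icc (-1 + κ / 2) (1 - κ / 2) ×ℂ Icc (-1 - 2 * κ) (-1)),
    Φ.symm ⁻¹' (Icc (-1 + κ / 2) (1 - κ / 2) ×ℂ Icc 1 (1 + 2 * κ)), r, h₁, h₂, hcardy,
    ⟨hr, ?_, ?_, ?_, hl1, hl2, hl3, hl4, hl5, hl6⟩, ⟨hr, hu⟩⟩
  · exact (isClosed_Icc.reProdIm isClosed_Icc).preimage Φ.symm.continuous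
  · exact (isClosed_Icc.reProdIm isClosed_Icc).preimage Φ.symm.continuous
  · refine disjoint_left.2 fun z hz hz' => ?_
    have h1 := (Complex.mem_reProdIm.1 hz).2.2
    have h2 := (Complex.mem_reProdIm.1 hz').2.1
    linarith

end Summit.CriticalPhenomena.CardyFormulaZ2.Cruxes.SquareFromVoronoiHub.VoronoiBlocks.Faithful

end
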